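import Summits.BirchSwinnertonDyer.BirchSwinnertonDyer.Theorems.GenusKolyvaginAtTwoPowDvdShaCardAtTwoRTOrderFourAuxiliaryAvoiding
import HarnessLib

/-!
# Route `GenusKolyvaginAtTwo`, crux L_T `PowDvdShaCardAtTwoRT` (stmt-BirchSwinnertonDyer-23242), LINE 18 stub L, bottom rung:
# THE AUXILIARY AVOIDING A FINITE SET — LEVEL `4` OVER `ℚ` AT GROSS–KOLYVAGIN PRIMES (`#B < 2^{#free places}`)

Width seat `bsd-line-gk2-p4` g18 (cell `bsd-f1-sign2`), `--supports 23242 --as helper`.  THEOREMS ONLY (no definition, no named fact,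
no `sorry`; standard axioms).  Sequel of `…RTOrderFourAuxiliaryAvoiding` (the abstract / canonical two-level count with a factor `#B`).
BSD is NOT proved by any of this; neither is the crux nor stub L.

WHY (LEAD memo `Lines/plus-descent-lead-g16.md` §11 finding (B): the LW phantom `φ₄` dies at every level-`4` Kolyvagin prime, so the
auxiliary must have `2•y ∉ {0, φ₄}`).  At levels `(2, 4)` over `ℚ` the local counts at a Gross–Kolyvagin prime of index `≥ 2` are
`#H¹(ℚ_u, E[2]) = 4`, `#H¹(ℚ_u, E[4]) = 16` (LEAD `natCard_galoisCohomology_one_toLocal_two_pow_eq`), so the numerical hypothesis of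
`exists_mem_solutions_nsmul_not_mem_canonical` reads **`#B · 8^{#T} < ∏_u #M_u`**:
* **`exists_mem_kummerOutside_four_two_nsmul_not_mem_of_card`** — ARBITRARY `M_u`, `#B · 8^{#T} < ∏ #M_u` ⟹ `∃ y ∈ H¹_{𝓛,⊤ on T}(ℚ,E[4])`,
  `loc_u y ∈ M_u`, `2•y ∉ B`;
* **`exists_mem_kummerOutside_four_two_nsmul_not_mem_of_free`** — `M_u = ⊤` on `S ⊆ T` with **`#B < 2^{#S}`**, `8 ≤ #M_u` everywhere
  (for `B = {0, φ₄}`: two free own primes, the LEAD's «free by counting when `k ≥ 2`»);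
* `two_nsmul_ne_of_not_mem_kummerOutside` — the free remark: a `φ` NOT in `H¹_{𝓛,⊤ on T}` is never `2•y` (the `k = 1` question is thus
  «is `φ₄` Kummer at `2` and at the bad primes»).
HONEST FRAMING: bookkeeping; closes nothing.  BSD is NOT proved by any of this.

References: [McCallumLMS1991] §2 Prop. 2.1, §5 proof of Prop. 5.2; [MilneADT2006] Ch. I Thm. 2.8, Thm. 4.10; [LawsonWuthrich2016].
-/

set_option autoImplicit false
-- the Theorems namespace of this sub repeats the summit name by design (D-0017 nested layout)
set_option linter.dupNamespace false

noncomputable section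

open scoped Classical

open CategoryTheory Field NumberField IsDedekindDomain Function
open _root_.WeierstrassCurve
open Literature.NumberTheory.EllipticCurves
open Literature.NumberTheory.GaloisRepresentations
open Literature.NumberTheory.GaloisCohomology
open Summit.BirchSwinnertonDyer.Rank1Residual.X11b.KummerPT
open Summit.BirchSwinnertonDyer.Rank1Residual.X11b.FiniteDuality
open Summit.BirchSwinnertonDyer.Rank1Residual.X11b.Relaxation
open Summit.BirchSwinnertonDyer.Rank1Residual.X11b.LocBridge Summit.BirchSwinnertonDyer.Rank1Residual.X11b.Levels
open Summit.BirchSwinnertonDyer.Rank1Residual.X11b.AcSelmer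
open scoped ContRepresentation

namespace Summit.BirchSwinnertonDyer.BirchSwinnertonDyer.Theorems.GenusExact.RelaxedCount

open Summit.BirchSwinnertonDyer.BirchSwinnertonDyer.Theorems.GenusExact.ReductionCyclic
open Summit.BirchSwinnertonDyer.BirchSwinnertonDyer.Theorems.GenusExact.LocalDualityOrder

/-! ## §3 Level `4` over `ℚ` at Gross–Kolyvagin primes of index `≥ 2` -/

section Rat

variable (W : WeierstrassCurve ℚ) [W.IsElliptic] [W.IsGloballyMinimal]

omit [W.IsElliptic] [W.IsGloballyMinimal] in
/-- **Free remark**: `2•y ∈ H¹_{𝓛,⊤ on T}` for every `y` there, so a class `φ ∉ H¹_{𝓛,⊤ on T}` is never `2•y`. [folklore] -/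
theorem two_nsmul_ne_of_not_mem_kummerOutside {m : ℕ} (T : Finset (Place ℚ))
    {y φ : galoisCohomology (W.torsionGaloisModule (m : ℤ)) 1} (hy : y ∈ kummerOutside W m T)
    (hφ : φ ∉ kummerOutside W m T) : (2 : ℕ) • y ≠ φ := fun h ↦ hφ (h ▸ (kummerOutside W m T).nsmul_mem hy 2)

/-- **The order-4 auxiliary avoiding `B`, ARBITRARY local conditions on `T`.**  `E/ℚ` with `Δ < 0` and `ρ̄_{E,2}` onto; `T` a finite set of
places of Gross–Kolyvagin primes (`ℓ ≠ 2`, good, `Frob_ℓ = Frob_∞` on `E[2]`, `kolyvaginIndex ≥ 2`); `M_u ≤ H¹(ℚ_u, E[4])` ANY conditions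
with **`#B · 8^{#T} < ∏_u #M_u`**.  Then `∃ y ∈ H¹_{𝓛,⊤ on T}(ℚ, E[4])` with `loc_u y ∈ M_u` (`u ∈ T`) and **`2•y ∉ B`**.
[cite: McCallumLMS1991, §2 Prop. 2.1 and §5 proof of Prop. 5.2] [cite: MilneADT2006, Ch. I, Thm. 4.10] -/
theorem exists_mem_kummerOutside_four_two_nsmul_not_mem_of_card (hΔ : W.Δ < 0) (hρ2 : W.HasSurjectiveModNGaloisRep 2)
    {K : Type} [Field K] [NumberField K] (T : Finset (Place ℚ))
    (hTK : ∀ u ∈ T, ∃ (v : HeightOneSpectrum (𝓞 ℚ)) (ℓ : ℕ) (_ : Fact ℓ.Prime), u = Sum.inr v ∧ ℓ ≠ 2 ∧ (ℓ : 𝓞 ℚ) ∈ v.asIdeal ∧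
      W.HasGoodReductionAtPrime ℓ ∧ FrobEqFrobInfty W K 2 ℓ ∧ 2 ≤ Zhang2014.kolyvaginIndex W 2 ℓ)
    (M : ∀ u : ↥T, AddSubgroup (galoisCohomology ((W.torsionGaloisModule ((2 ^ 2 : ℕ) : ℤ)).toLocal (u : Place ℚ)) 1))
    (B : Finset (galoisCohomology (W.torsionGaloisModule ((2 ^ 2 : ℕ) : ℤ)) 1))
    (hM : B.card * 8 ^ T.card < ∏ u : ↥T, Nat.card (M u)) :
    ∃ y ∈ kummerOutside W (2 ^ 2) T,
      (∀ u : ↥T, galoisCohomology.localization (W.torsionGaloisModule ((2 ^ 2 : ℕ) : ℤ)) (u : Place ℚ) 1 y ∈ M u) ∧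
        (2 : ℕ) • y ∉ B := by
  classical
  haveI : Fact (Nat.Prime 2) := ⟨Nat.prime_two⟩
  -- local counts on `T`
  have hcount : ∀ (N : ℕ), N ≠ 0 → N ≤ 2 → ∀ u : ↥T,
      Nat.card (galoisCohomology ((W.torsionGaloisModule ((2 ^ N : ℕ) : ℤ)).toLocal (u : Place ℚ)) 1) = 4 ^ N := by
    intro N hN0 hN2 u
    obtain ⟨v, ℓ, hℓp, hu, hℓ2, hv, hgood, hFrob, hidx⟩ := hTK u u.2
    rw [hu]
    exact natCard_galoisCohomology_one_toLocal_two_pow_eq W hΔ hℓ2 hgood hFrob hv hN0 (hN2.trans hidx)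
  -- Weil pairings at levels 2 and 4
  obtain ⟨e₂, hμ₂, hadd₁₂, hadd₂₂, halt₂, hnondeg₂, hgal₂⟩ :=
    W.exists_weilPairing_holds (2 ^ 1) (by norm_num) (by norm_num)
  obtain ⟨e₄, hμ₄, hadd₁₄, hadd₂₄, halt₄, hnondeg₄, hgal₄⟩ :=
    W.exists_weilPairing_holds (2 ^ 2) (by norm_num) (by norm_num)
  -- product localisations
  set loc₂ : galoisCohomology (W.torsionGaloisModule ((2 ^ 1 : ℕ) : ℤ)) 1 →+
      (∀ u : ↥T, galoisCohomology ((W.torsionGaloisModule ((2 ^ 1 : ℕ) : ℤ)).toLocal (u : Place ℚ)) 1) :=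
    AddMonoidHom.pi fun u ↦ galoisCohomology.localization (W.torsionGaloisModule ((2 ^ 1 : ℕ) : ℤ)) (u : Place ℚ) 1 with hloc₂d
  set loc₄ : galoisCohomology (W.torsionGaloisModule ((2 ^ 2 : ℕ) : ℤ)) 1 →+
      (∀ u : ↥T, galoisCohomology ((W.torsionGaloisModule ((2 ^ 2 : ℕ) : ℤ)).toLocal (u : Place ℚ)) 1) :=
    AddMonoidHom.pi fun u ↦ galoisCohomology.localization (W.torsionGaloisModule ((2 ^ 2 : ℕ) : ℤ)) (u : Place ℚ) 1 with hloc₄d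
  have hloc₂ : ∀ c u, loc₂ c u = galoisCohomology.localization (W.torsionGaloisModule ((2 ^ 1 : ℕ) : ℤ)) (u : Place ℚ) 1 c :=
    fun c u ↦ rfl
  have hloc₄ : ∀ c u, loc₄ c u = galoisCohomology.localization (W.torsionGaloisModule ((2 ^ 2 : ℕ) : ℤ)) (u : Place ℚ) 1 c :=
    fun c u ↦ rfl
  -- the level map
  have hdvd : ((2 ^ 1 : ℕ) : ℤ) ∣ ((2 ^ (1 + 1) : ℕ) : ℤ) := by norm_num
  have hι : Injective (galoisCohomology.map (W.torsionInclusion hdvd) 1) := by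
    intro x y hxy
    rw [map_torsionInclusion_one_apply, map_torsionInclusion_one_apply] at hxy
    exact VisiblePairAtTwo.torsionH1OfDvd_pow_injective W (p := 2) (VisiblePairAtTwo.torsionBy_two_eq_bot_of_surj W hρ2) hdvd hxy
  -- the numerical hypothesis: `#B² · ∏ 4 · ∏ 16 = (#B · 8 ^ #T)² < (∏ #M_u)²`
  have h2 : ∀ u : ↥T, Nat.card (galoisCohomology ((W.torsionGaloisModule ((2 ^ 1 : ℕ) : ℤ)).toLocal (u : Place ℚ)) 1) = 4 :=
    fun u ↦ by rw [hcount 1 one_ne_zero (by norm_num) u, pow_one]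
  have h4 : ∀ u : ↥T, Nat.card (galoisCohomology ((W.torsionGaloisModule ((2 ^ (1 + 1) : ℕ) : ℤ)).toLocal (u : Place ℚ)) 1) =
      16 := fun u ↦ by rw [hcount (1 + 1) (by norm_num) le_rfl u]; norm_num
  have hlt : B.card ^ 2 *
      ((∏ u : ↥T, Nat.card (galoisCohomology ((W.torsionGaloisModule ((2 ^ 1 : ℕ) : ℤ)).toLocal (u : Place ℚ)) 1)) *
      (∏ u : ↥T, Nat.card (galoisCohomology ((W.torsionGaloisModule ((2 ^ (1 + 1) : ℕ) : ℤ)).toLocal (u : Place ℚ)) 1))) <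
      (∏ u : ↥T, Nat.card (M u)) ^ 2 := by
    rw [Finset.prod_congr rfl fun u _ ↦ h2 u, Finset.prod_congr rfl fun u _ ↦ h4 u, Finset.prod_const, Finset.prod_const,
      Finset.card_univ, Fintype.card_coe, ← mul_pow]
    have h64 : B.card ^ 2 * (4 * 16) ^ T.card = (B.card * 8 ^ T.card) ^ 2 := by
      have h' : ((4 : ℕ) * 16) ^ T.card = (8 ^ T.card) ^ 2 := by rw [sq, ← mul_pow]; norm_num
      rw [h', ← mul_pow]
    rw [h64]
    exact Nat.pow_lt_pow_left hM two_ne_zero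
  obtain ⟨y, hy, hy2⟩ := exists_mem_solutions_nsmul_not_mem_canonical W 2 1 (1 + 1) e₂ hμ₂ hadd₁₂ hadd₂₂ hgal₂ halt₂ hnondeg₂
    e₄ hμ₄ hadd₁₄ hadd₂₄ hgal₄ halt₄ hnondeg₄ one_pos (by norm_num) 2 T loc₂ hloc₂ loc₄ hloc₄
    (galoisCohomology.map (W.torsionInclusion hdvd) 1) hι
    (fun c hc ↦ (map_torsionInclusion_mem_kummerOutside_iff W hdvd T c).mpr hc)
    (fun y hyT hy ↦ exists_map_torsionInclusion_eq_of_mem_kummerOutside W 2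
      (VisiblePairAtTwo.torsionBy_two_eq_bot_of_surj W hρ2) 1 1 hdvd T y hyT (by simpa using hy))
    (fun c u hc ↦ by
      rw [hloc₄]
      exact localization_map_torsionInclusion_eq_zero W hdvd (u : Place ℚ) c (by rw [← hloc₂]; exact hc))
    M B hlt
  have hyM : y ∈ (AddSubgroup.pi Set.univ M).comap loc₄ := (AddSubgroup.mem_inf.mp hy).2
  rw [AddSubgroup.mem_comap, AddSubgroup.mem_pi] at hyM
  refine ⟨y, (AddSubgroup.mem_inf.mp hy).1, fun u ↦ ?_, hy2⟩
  rw [← hloc₄]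
  exact hyM u (Set.mem_univ _)

/-- **The order-4 auxiliary avoiding `B`, from free places**: with `M_u = ⊤` at the places of a set `S ⊆ T` (free own primes) with
**`#B < 2^{#S}`** and `8 ≤ #M_u` at every place of `T`, there is `y ∈ H¹_{𝓛,⊤ on T}(ℚ, E[4])` with `loc_u y ∈ M_u` (`u ∈ T`) and `2•y ∉ B`
(`∏ #M_u ≥ 16^{#S}·8^{#T−#S} = 2^{#S}·8^{#T}`).  For `B = {0, φ₄}` (the LW phantom): `#S ≥ 2`. [cite: McCallumLMS1991, §5 proof of Prop. 5.2] -/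
theorem exists_mem_kummerOutside_four_two_nsmul_not_mem_of_free (hΔ : W.Δ < 0) (hρ2 : W.HasSurjectiveModNGaloisRep 2)
    {K : Type} [Field K] [NumberField K] (T : Finset (Place ℚ))
    (hTK : ∀ u ∈ T, ∃ (v : HeightOneSpectrum (𝓞 ℚ)) (ℓ : ℕ) (_ : Fact ℓ.Prime), u = Sum.inr v ∧ ℓ ≠ 2 ∧ (ℓ : 𝓞 ℚ) ∈ v.asIdeal ∧
      W.HasGoodReductionAtPrime ℓ ∧ FrobEqFrobInfty W K 2 ℓ ∧ 2 ≤ Zhang2014.kolyvaginIndex W 2 ℓ)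
    (M : ∀ u : ↥T, AddSubgroup (galoisCohomology ((W.torsionGaloisModule ((2 ^ 2 : ℕ) : ℤ)).toLocal (u : Place ℚ)) 1))
    (B : Finset (galoisCohomology (W.torsionGaloisModule ((2 ^ 2 : ℕ) : ℤ)) 1))
    (S : Finset (Place ℚ)) (hST : S ⊆ T) (hB : B.card < 2 ^ S.card)
    (hfree : ∀ u : ↥T, (u : Place ℚ) ∈ S → M u = ⊤) (h8 : ∀ u : ↥T, 8 ≤ Nat.card (M u)) :
    ∃ y ∈ kummerOutside W (2 ^ 2) T,
      (∀ u : ↥T, galoisCohomology.localization (W.torsionGaloisModule ((2 ^ 2 : ℕ) : ℤ)) (u : Place ℚ) 1 y ∈ M u) ∧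
        (2 : ℕ) • y ∉ B := by
  classical
  refine exists_mem_kummerOutside_four_two_nsmul_not_mem_of_card W hΔ hρ2 T hTK M B ?_
  -- `∏ #M_u ≥ 16^{#S'} · 8^{#(T∖S')}` with `S' = {u ∈ T | u ∈ S}` of the same size as `S`
  have h16 : ∀ u : ↥T, (u : Place ℚ) ∈ S → Nat.card (M u) = 16 := by
    intro u hu
    obtain ⟨v, ℓ, hℓp, huv, hℓ2, hv, hgood, hFrob, hidx⟩ := hTK u u.2
    rw [hfree u hu, AddSubgroup.card_top]
    have h := natCard_galoisCohomology_one_toLocal_two_pow_eq W hΔ hℓ2 hgood hFrob hv two_ne_zero hidx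
    rw [← huv] at h
    rw [h]; norm_num
  set S' : Finset ↥T := Finset.univ.filter fun u ↦ (u : Place ℚ) ∈ S with hS'
  have hS'card : S'.card = S.card := by
    rw [hS']
    refine Finset.card_bij (fun u _ ↦ (u : Place ℚ)) (fun u hu ↦ (Finset.mem_filter.mp hu).2) (fun u _ u' _ h ↦ Subtype.ext h)
      fun w hw ↦ ⟨⟨w, hST hw⟩, Finset.mem_filter.mpr ⟨Finset.mem_univ _, hw⟩, rfl⟩
  have hsplit : (∏ u : ↥T, Nat.card (M u)) = (∏ u ∈ S', Nat.card (M u)) * ∏ u ∈ Finset.univ \ S', Nat.card (M u) := by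
    rw [← Finset.prod_union Finset.disjoint_sdiff, Finset.union_sdiff_of_subset (Finset.subset_univ _)]
  have hS'prod : (∏ u ∈ S', Nat.card (M u)) = 16 ^ S'.card := by
    rw [Finset.prod_congr rfl fun u hu ↦ h16 u (Finset.mem_filter.mp hu).2, Finset.prod_const]
  have hrest : 8 ^ (Finset.univ \ S').card ≤ ∏ u ∈ Finset.univ \ S', Nat.card (M u) :=
    Finset.pow_card_le_prod _ _ _ fun u _ ↦ h8 u
  have hcardT : S'.card + (Finset.univ \ S').card = T.card := by
    rw [Finset.card_sdiff_of_subset (Finset.subset_univ _), Finset.card_univ, Fintype.card_coe]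
    have : S'.card ≤ T.card := by
      calc S'.card ≤ (Finset.univ : Finset ↥T).card := Finset.card_le_card (Finset.subset_univ _)
        _ = T.card := by rw [Finset.card_univ, Fintype.card_coe]
    omega
  calc B.card * 8 ^ T.card < 2 ^ S.card * 8 ^ T.card := Nat.mul_lt_mul_of_pos_right hB (by positivity)
    _ = 16 ^ S'.card * 8 ^ (Finset.univ \ S').card := by
        rw [← hcardT, pow_add, hS'card, ← mul_assoc, ← mul_pow]; norm_num
    _ ≤ (∏ u ∈ S', Nat.card (M u)) * ∏ u ∈ Finset.univ \ S', Nat.card (M u) := by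
        rw [hS'prod]; exact Nat.mul_le_mul_left _ hrest
    _ = ∏ u : ↥T, Nat.card (M u) := hsplit.symm

end Rat

end Summit.BirchSwinnertonDyer.BirchSwinnertonDyer.Theorems.GenusExact.RelaxedCount

end
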